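import Mathlib.Analysis.Calculus.IteratedDeriv.Lemmas
import Mathlib.Analysis.Calculus.Deriv.Add
import HarnessLib

/-!
# The iterated-derivative ladder of a second-order recursion `(G f)″ = G (A f)` (Harish-Chandra's radial Casimir equation, abstract form)
# (Varadarajan 1989 §6.4 Thm 24, §6.6: `F_{Ωf} = ±(F_f″ ∓ F_f)` climbs the orders two at a time)

Topic `Analysis/Calculus`; namespace `Literature.Analysis.Calculus`.  THEOREMS ONLY (no `def`, no instance, no notation, no axiom, no named fact, no `sorry`), Mathlib only.
Cell `pub/hodgecm-mathlib`, line LH3 (crux H413 = `stmt-HodgeConjecture-24833`), generic calculus brick for the rank-one Casimir ladders: the elliptic side uses the recursion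
`F″ = −(F + F_Ω)` (★ `ArchRankOneCasimirLadder` §1, this seat), the SPLIT side `Λ″ = Λ + Λ_Ω = Λ_{(1+Ω)g}` (★ `casimir_integral_prod_conj_hypBlockGL_eq`, F0P3a-p09 (g6) (A0-CASIMIR-∞)); this
file is the sign-free common form `(G f)″ = G (A f)` for any self-map `A` of the index set, consumable by both; author LH3-p04 (g4).

THE MATHEMATICS.  `S` any index type, `A : S → S`, `G : S → ℝ → E` (`E` real normed), `U ⊆ ℝ` open, and on `U`: `G f` has derivative `(G f)′`, `(G f)′` has derivative `G (A f)`.  Then by a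
two-step induction every iterated derivative of every `G f` exists on `U`, `(G f)⁽ⁿ⁾` has derivative `(G f)⁽ⁿ⁺¹⁾`, `(G f)⁽ⁿ⁺²⁾ = (G (A f))⁽ⁿ⁾`, hence the closed forms `(G f)⁽²ᵏ⁾ = G (Aᵏ f)`,
`(G f)⁽²ᵏ⁺¹⁾ = (G (Aᵏ f))′` on `U`, and the corresponding statements for limits along any filter eventually inside `U` (one-sided limits at a wall point).
HONEST LABEL: elementary one-variable calculus; pays nothing by itself (HC_CM is proved only modulo the 7 printed citations (2 remaining: hLiu418 = stmt-HodgeConjecture-24832,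
h413 = stmt-HodgeConjecture-24833) until rung 0 closes); count-neutral.

WHAT IS PROVED: **`hasDerivAt_iteratedDeriv_and_ladder_of_deriv_two_eq`**, **`iteratedDeriv_eq_iterate_of_deriv_two_eq`**, `tendsto_iteratedDeriv_add_two_of_deriv_two_eq`,
**`tendsto_iteratedDeriv_of_deriv_two_eq`**.

## References
* [Varadarajan1989] V. S. Varadarajan, *An Introduction to Harmonic Analysis on Semisimple Lie Groups*, Cambridge Stud. Adv. Math. 16 (1989), §6.3, §6.4 Thms 22–24, §6.6.
-/

set_option autoImplicit false

namespace Literature.Analysis.Calculus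

open Set Filter Topology

variable {E : Type*} [NormedAddCommGroup E] [NormedSpace ℝ E]


/-- **THE LADDER FOR `(G f)″ = G (A f)`** (any map `A : S → S`; the split torus has `Λ_g″ = Λ_g + Λ_{Ωg} = Λ_{(1+Ω)g}`, ★ `casimir_integral_prod_conj_hypBlockGL_eq`, F0P3a-p09 (g6)):
on an open `U` where every `G f` has derivative `(G f)′` and `(G f)′` has derivative `G (A f)`, every iterated derivative exists on `U`, `(G f)⁽ⁿ⁾` has derivative `(G f)⁽ⁿ⁺¹⁾ ψ`,
and `(G f)⁽ⁿ⁺²⁾ ψ = (G (A f))⁽ⁿ⁾ ψ`. [cite: Varadarajan1989, §6.4 Thm 24; §6.6] -/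
theorem hasDerivAt_iteratedDeriv_and_ladder_of_deriv_two_eq {S : Type*} (A : S → S) (G : S → ℝ → E) {U : Set ℝ} (hU : IsOpen U)
    (h : ∀ f, ∀ ψ ∈ U, HasDerivAt (G f) (deriv (G f) ψ) ψ ∧ HasDerivAt (deriv (G f)) (G (A f) ψ) ψ)
    (n : ℕ) (f : S) {ψ : ℝ} (hψ : ψ ∈ U) :
    HasDerivAt (iteratedDeriv n (G f)) (iteratedDeriv (n + 1) (G f) ψ) ψ ∧
      iteratedDeriv (n + 2) (G f) ψ = iteratedDeriv n (G (A f)) ψ := by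
  have base0 : ∀ f, ∀ ψ ∈ U, HasDerivAt (iteratedDeriv 0 (G f)) (iteratedDeriv 1 (G f) ψ) ψ ∧
      iteratedDeriv 2 (G f) ψ = iteratedDeriv 0 (G (A f)) ψ := by
    intro f ψ hψ
    refine ⟨?_, ?_⟩
    · rw [iteratedDeriv_zero, iteratedDeriv_one]; exact (h f ψ hψ).1
    · rw [show (2 : ℕ) = 1 + 1 from rfl, iteratedDeriv_succ, iteratedDeriv_one, iteratedDeriv_zero]
      exact (h f ψ hψ).2.deriv
  have step : ∀ n, (∀ f, ∀ ψ ∈ U, HasDerivAt (iteratedDeriv n (G f)) (iteratedDeriv (n + 1) (G f) ψ) ψ ∧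
        iteratedDeriv (n + 2) (G f) ψ = iteratedDeriv n (G (A f)) ψ) →
      ∀ f, ∀ ψ ∈ U, HasDerivAt (iteratedDeriv (n + 2) (G f)) (iteratedDeriv (n + 1) (G (A f)) ψ) ψ := by
    intro n hn f ψ hψ
    have hev : iteratedDeriv (n + 2) (G f) =ᶠ[𝓝 ψ] fun y => iteratedDeriv n (G (A f)) y := by
      filter_upwards [hU.mem_nhds hψ] with y hy
      exact (hn f y hy).2
    exact ((hn (A f) ψ hψ).1).congr_of_eventuallyEq hev
  have pair : ∀ n, (∀ f, ∀ ψ ∈ U, HasDerivAt (iteratedDeriv n (G f)) (iteratedDeriv (n + 1) (G f) ψ) ψ ∧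
        iteratedDeriv (n + 2) (G f) ψ = iteratedDeriv n (G (A f)) ψ) ∧
      (∀ f, ∀ ψ ∈ U, HasDerivAt (iteratedDeriv (n + 1) (G f)) (iteratedDeriv (n + 1 + 1) (G f) ψ) ψ ∧
        iteratedDeriv (n + 1 + 2) (G f) ψ = iteratedDeriv (n + 1) (G (A f)) ψ) := by
    intro n
    induction n with
    | zero =>
      refine ⟨base0, fun f ψ hψ => ⟨?_, ?_⟩⟩
      · have h2 := (base0 f ψ hψ).2
        rw [iteratedDeriv_zero] at h2
        rw [zero_add, iteratedDeriv_one, show (1 + 1 : ℕ) = 2 from rfl, h2]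
        exact (h f ψ hψ).2
      · have he : iteratedDeriv (0 + 1 + 2) (G f) ψ = deriv (iteratedDeriv (0 + 2) (G f)) ψ := by
          rw [show (0 + 1 + 2 : ℕ) = (0 + 2) + 1 from rfl, iteratedDeriv_succ]
        rw [he, (step 0 base0 f ψ hψ).deriv, zero_add, iteratedDeriv_one]
    | succ n ih =>
      obtain ⟨hn, hn1⟩ := ih
      refine ⟨hn1, fun f ψ hψ => ⟨?_, ?_⟩⟩
      · have hs := step n hn f ψ hψ
        have he : iteratedDeriv (n + 1 + 1 + 1) (G f) ψ = iteratedDeriv (n + 1) (G (A f)) ψ := by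
          rw [show (n + 1 + 1 + 1 : ℕ) = (n + 2) + 1 from rfl, iteratedDeriv_succ, hs.deriv]
        rw [he]
        exact hs
      · have he : iteratedDeriv (n + 1 + 1 + 2) (G f) ψ = deriv (iteratedDeriv (n + 1 + 2) (G f)) ψ := by
          rw [show (n + 1 + 1 + 2 : ℕ) = (n + 1 + 2) + 1 from rfl, iteratedDeriv_succ]
        rw [he, (step (n + 1) hn1 f ψ hψ).deriv, show (n + 1 + 1 : ℕ) = (n + 1) + 1 from rfl, iteratedDeriv_succ]
  exact (pair n).1 f ψ hψ

/-- **Closed form on `U`: `(G f)⁽²ᵏ⁾ = G (Aᵏ f)` and `(G f)⁽²ᵏ⁺¹⁾ = (G (Aᵏ f))′`** for the recursion `(G f)″ = G (A f)`. [cite: Varadarajan1989, §6.4 Thm 24] -/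
theorem iteratedDeriv_eq_iterate_of_deriv_two_eq {S : Type*} (A : S → S) (G : S → ℝ → E) {U : Set ℝ} (hU : IsOpen U)
    (h : ∀ f, ∀ ψ ∈ U, HasDerivAt (G f) (deriv (G f) ψ) ψ ∧ HasDerivAt (deriv (G f)) (G (A f) ψ) ψ)
    (k : ℕ) (f : S) {ψ : ℝ} (hψ : ψ ∈ U) :
    iteratedDeriv (2 * k) (G f) ψ = G (A^[k] f) ψ ∧ iteratedDeriv (2 * k + 1) (G f) ψ = deriv (G (A^[k] f)) ψ := by
  induction k generalizing f with
  | zero => simp only [Nat.mul_zero, iteratedDeriv_zero, Function.iterate_zero, id_eq, zero_add, iteratedDeriv_one, and_self]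
  | succ k ih =>
    have h2 : ∀ m, iteratedDeriv (m + 2) (G f) ψ = iteratedDeriv m (G (A f)) ψ := fun m =>
      (hasDerivAt_iteratedDeriv_and_ladder_of_deriv_two_eq A G hU h m f hψ).2
    rw [show 2 * (k + 1) = 2 * k + 2 by ring, show 2 * k + 2 + 1 = (2 * k + 1) + 2 by ring, h2, h2, Function.iterate_succ_apply]
    exact ih (A f)

/-- **Limits along the `(G f)″ = G (A f)` ladder**: along any `l` eventually in `U`, `(G (A f))⁽ⁿ⁾ → B` implies `(G f)⁽ⁿ⁺²⁾ → B`; hence `(G f)⁽²ᵏ⁾` has the limit of `G (Aᵏ f)` and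
`(G f)⁽²ᵏ⁺¹⁾` that of `(G (Aᵏ f))′`. [cite: Varadarajan1989, §6.4 Thm 24] -/
theorem tendsto_iteratedDeriv_add_two_of_deriv_two_eq {S : Type*} (A : S → S) (G : S → ℝ → E) {U : Set ℝ} (hU : IsOpen U)
    (h : ∀ f, ∀ ψ ∈ U, HasDerivAt (G f) (deriv (G f) ψ) ψ ∧ HasDerivAt (deriv (G f)) (G (A f) ψ) ψ)
    {l : Filter ℝ} (hl : ∀ᶠ ψ in l, ψ ∈ U) (n : ℕ) (f : S) {B : E}
    (hB : Tendsto (fun ψ => iteratedDeriv n (G (A f)) ψ) l (𝓝 B)) :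
    Tendsto (fun ψ => iteratedDeriv (n + 2) (G f) ψ) l (𝓝 B) := by
  refine hB.congr' ?_
  filter_upwards [hl] with ψ hψ
  exact ((hasDerivAt_iteratedDeriv_and_ladder_of_deriv_two_eq A G hU h n f hψ).2).symm

/-- Closed-form limits: `(G f)⁽²ᵏ⁾` tends along `l` to the limit of `G (Aᵏ f)`, and `(G f)⁽²ᵏ⁺¹⁾` to the limit of `(G (Aᵏ f))′`. [cite: Varadarajan1989, §6.4 Thm 24] -/
theorem tendsto_iteratedDeriv_of_deriv_two_eq {S : Type*} (A : S → S) (G : S → ℝ → E) {U : Set ℝ} (hU : IsOpen U)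
    (h : ∀ f, ∀ ψ ∈ U, HasDerivAt (G f) (deriv (G f) ψ) ψ ∧ HasDerivAt (deriv (G f)) (G (A f) ψ) ψ)
    {l : Filter ℝ} (hl : ∀ᶠ ψ in l, ψ ∈ U) (k : ℕ) (f : S) {B B' : E}
    (hB : Tendsto (G (A^[k] f)) l (𝓝 B)) (hB' : Tendsto (fun ψ => deriv (G (A^[k] f)) ψ) l (𝓝 B')) :
    Tendsto (fun ψ => iteratedDeriv (2 * k) (G f) ψ) l (𝓝 B) ∧ Tendsto (fun ψ => iteratedDeriv (2 * k + 1) (G f) ψ) l (𝓝 B') := by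
  constructor
  · refine hB.congr' ?_
    filter_upwards [hl] with ψ hψ
    exact ((iteratedDeriv_eq_iterate_of_deriv_two_eq A G hU h k f hψ).1).symm
  · refine hB'.congr' ?_
    filter_upwards [hl] with ψ hψ
    exact ((iteratedDeriv_eq_iterate_of_deriv_two_eq A G hU h k f hψ).2).symm


end Literature.Analysis.Calculus
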